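import Summits.AtomisticToContinuum.FouriersLaw.Theses.JunctionLocality
import Literature.Barriers.AtomisticToContinuum.HarmonicCrystalBallisticProofs

/-!
# `ConductanceLowerBound` / Negative: the harmonic corner satisfies the LOWER bound

Hypothesis-mutation record for crux `stmt-AtomisticToContinuum-11749`
(`JunctionLocality.ConductanceLowerBound`), crux-disprover generation 2 (2026-08-15):
`0 < lam` and `0 < β` are NOT load-bearing for the LOWER half of Fourier's law.  At the
integrable corner `lam = β = 0` (pinned HARMONIC chain, same sign conventions) the proved
ballistic law (`HarmonicChainBallisticFlux_holds`: Rieder–Lebowitz–Lieb / Nakazawa / Roy–Dhar,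
every bond carries `c_N (T_L - T_R)` with `c_N → c_∞ > 0`) gives, along the Gaussian
steady-state family, response coefficients `D_{M+1} = M c_{M+1}` which satisfy the crux's
conclusion `∃ c > 0 ∃ N₁ ∀ N ≥ N₁, c ≤ D_N` and even tend to `+∞`, while the conclusion of the
companion crux `NonBallistic` FAILS.  So (i) the orientation of `bondCurrent` / `T_L` at site `0`
makes `D ≥ 0` the physical sign; (ii) anharmonicity is the obstacle to, never the engine of, a
proof of the lower bound (it powers the UPPER half); (iii) the pair "(C) true, (B) false" is
realised in the model class, so (C) carries no finiteness information.  Nothing here closes an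
item (the statements concern `pinnedChain ω₂ 0 0 γ`, outside the crux's parameter range).
-/

noncomputable section

namespace Summit.AtomisticToContinuum.FouriersLaw.Theorems

open MeasureTheory Filter Topology
open Literature.MathematicalPhysics.KineticTheory.HeatConduction

/-- **Harmonic corner of `ConductanceLowerBound`: the lower bound holds, ballistically.**  For
`pinnedChain ω₂ 0 0 γ` (`ω₂, γ > 0`) there is a steady-state family along which, at every
`T > 0`, the finite-`N` response coefficients exist, are eventually `≥ 1`, and tend to `+∞`;
in particular the conclusion of `NonBallistic` fails along it. [folklore] -/
theorem conductanceLowerBound_harmonic_corner {ω₂ γ : ℝ} (hω : 0 < ω₂) (hγ : 0 < γ) :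
    ∃ μ : (N : ℕ) → ℝ → ℝ → Measure (PhaseSpace N),
      (∀ (N : ℕ) (T_L T_R : ℝ), 0 < T_L → 0 < T_R →
        (pinnedChain ω₂ 0 0 γ).IsSteadyState N T_L T_R (μ N T_L T_R)) ∧
      ∀ T : ℝ, 0 < T → ∃ D : ℕ → ℝ,
        (∀ N : ℕ, Tendsto (fun δ : ℝ =>
          (pinnedChain ω₂ 0 0 γ).totalCurrent (μ N (T + δ / 2) (T - δ / 2)) / δ)
          (𝓝[≠] 0) (𝓝 (D N))) ∧
        (∃ c : ℝ, 0 < c ∧ ∃ N₁ : ℕ, ∀ N : ℕ, N₁ ≤ N → c ≤ D N) ∧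
        Tendsto D atTop atTop ∧
        ¬ (∀ ε : ℝ, 0 < ε → ∀ N₀ : ℕ, ∃ N : ℕ, N₀ ≤ N ∧ D N ≤ ε * ((N : ℝ) - 1)) := by
  obtain ⟨μ, hμ, c, cinf, hcinf, hresp, hrate, hdiv⟩ :=
    Literature.Barriers.AtomisticToContinuum.HarmonicChainBallisticFlux_holds.ballisticLaw hω hγ
  refine ⟨μ, hμ, fun T hT => ?_⟩
  -- D_N := (N - 1) c_N, i.e. D_{M+1} = M c_{M+1} and D_0 = 0
  set D : ℕ → ℝ := fun N => ((N - 1 : ℕ) : ℝ) * c N with hD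
  have hDg : D = (fun M : ℕ => (M : ℝ) * c (M + 1)) ∘ fun N : ℕ => N - 1 := by
    funext N
    cases N with
    | zero => simp [hD]
    | succ M => simp [hD]
  have hDdiv : Tendsto D atTop atTop := by
    rw [hDg]
    exact hdiv.comp (tendsto_sub_atTop_nat 1)
  refine ⟨D, fun N => ?_, ?_, hDdiv, ?_⟩
  · cases N with
    | zero =>
      simp only [OscillatorChain.totalCurrent_zero, zero_div, hD]
      simp
    | succ M =>
      have e : D (M + 1) = (M : ℝ) * c (M + 1) := by simp [hD]
      rw [e]
      exact hresp T hT M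
  · obtain ⟨N₁, hN₁⟩ := eventually_atTop.mp (hDdiv.eventually_ge_atTop 1)
    exact ⟨1, one_pos, N₁, hN₁⟩
  · intro hnb
    have hev : ∀ᶠ M : ℕ in atTop, cinf / 2 < (M : ℝ) * c (M + 1) / M :=
      hrate.eventually_const_lt (by linarith)
    obtain ⟨M₀, hM₀⟩ := eventually_atTop.mp hev
    obtain ⟨N, hN, hle⟩ := hnb (cinf / 2) (by linarith) (M₀ + 2)
    obtain ⟨M, rfl⟩ : ∃ M, N = M + 1 := ⟨N - 1, by omega⟩
    have hM : M₀ ≤ M := by omega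
    have hMpos : (0 : ℝ) < M := by exact_mod_cast (by omega : 0 < M)
    have h1 := hM₀ M hM
    have e : D (M + 1) = (M : ℝ) * c (M + 1) := by simp [hD]
    rw [e] at hle
    have e2 : ((M + 1 : ℕ) : ℝ) - 1 = M := by push_cast; ring
    rw [e2] at hle
    rw [lt_div_iff₀ hMpos] at h1
    linarith

/-- Consequently the variant of the crux's body with the anharmonic couplings switched OFF
(`lam = β = 0`), stated along SOME steady-state family (uniqueness of the harmonic weak NESS is
not in tree), is TRUE — so no refutation of `ConductanceLowerBound` can come from the harmonic
limit, and `0 < lam`, `0 < β` are not load-bearing for it. [folklore] -/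
theorem conductanceLowerBound_harmonic_corner_lowerBound {ω₂ γ : ℝ} (hω : 0 < ω₂) (hγ : 0 < γ) :
    ∃ μ : (N : ℕ) → ℝ → ℝ → Measure (PhaseSpace N),
      (∀ (N : ℕ) (T_L T_R : ℝ), 0 < T_L → 0 < T_R →
        (pinnedChain ω₂ 0 0 γ).IsSteadyState N T_L T_R (μ N T_L T_R)) ∧
      ∀ T : ℝ, 0 < T → ∀ D : ℕ → ℝ,
        (∀ N : ℕ, Tendsto (fun δ : ℝ =>
          (pinnedChain ω₂ 0 0 γ).totalCurrent (μ N (T + δ / 2) (T - δ / 2)) / δ)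
          (𝓝[≠] 0) (𝓝 (D N))) →
        ∃ c : ℝ, 0 < c ∧ ∃ N₁ : ℕ, ∀ N : ℕ, N₁ ≤ N → c ≤ D N := by
  obtain ⟨μ, hμ, h⟩ := conductanceLowerBound_harmonic_corner hω hγ
  refine ⟨μ, hμ, fun T hT D hD => ?_⟩
  obtain ⟨D', hD', hlb, -, -⟩ := h T hT
  have hDD' : D = D' := funext fun N => tendsto_nhds_unique (hD N) (hD' N)
  subst hDD'
  exact hlb

end Summit.AtomisticToContinuum.FouriersLaw.Theorems

end
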